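import Literature.NumberTheory.EllipticCurves.SwanConductorTorsionDichotomyProofs
import Literature.NumberTheory.EllipticCurves.TateModuleGaloisTransportProofs
import Literature.NumberTheory.EllipticCurves.QuadraticTwistTameTorsionSwanProofs
import Literature.NumberTheory.GaloisRepresentations.SqrtUpperRamificationProofs
import HarnessLib

/-!
# The wild conductor of a quadratic twist: `Sw_𝔓(V_ℓ E^{(d)}) = max (Sw_𝔓(V_ℓ E), 2 u_d)`

`Proofs` file (theorems only, no definitions, no named facts) in topic
`NumberTheory/EllipticCurves`, landed by the seat of
`Literature.NumberTheory.EllipticCurves.conductorNorm_eq_artinConductorNat` (bsd.S15 / C15,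
Silverman *ATAEC* §IV.10–11) as a general tool for the one leaf of Ogg's formula left over `ℚ`
(Saito's half at `2` for the potentially good curves with `ord₂(j) > 0`, `j ≠ 0`, and non-abelian
inertia on `E[3]`).

## The theorem

Let `E/K` be an elliptic curve over a number field, `ℓ` an **odd** prime, `v ∤ ℓ` a finite place,
`𝔓 ∣ v` a prime of `\bar ℤ_K`, `d ∈ K^×`, and write (`Γ^u = Γ_K^u(𝔓)`, the absolute upper
ramification groups, item C9)

* `S_E = {u > 0 : Γ^u moves E[ℓ]}`, of measure `Sw_𝔓(V_ℓ E) / 2`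
  (`swanConductorAt_rationalTate_eq_two_mul_volume`, *ATAEC* p. 370 in the upper numbering);
* `S_d = {u > 0 : Γ^u moves √d}`, of measure `u_d`, the upper break of `K(√d)` at `𝔓`
  (`0` if `𝔓` is unramified in `K(√d)`; over `ℚ` at `2`: `1` for `d ≡ 3 (mod 4)`, `2` for
  `d ≡ 2 (mod 4)`, `SqrtUpperRamificationProofs`);
* `S' = {u > 0 : Γ^u moves E^{(d)}[ℓ]}`, of measure `Sw_𝔓(V_ℓ E^{(d)}) / 2`.

All three are initial intervals of `(0, ∞)`.  Along the isomorphism `f : E^{(d)}(K̄) ≃ E(K̄)` with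
`f(σP) = ε_d(σ) σ f(P)`, `ε_d(σ) = σ√d/√d = ±1` (*AEC* X.5 Cor. 5.4;
`exists_addEquiv_geomPoints_quadraticTwist_sign`), an element `σ ∈ Γ_K` fixes `E^{(d)}[ℓ]`
pointwise iff it acts on `E[ℓ]` as the scalar `ε_d(σ)`.  Hence

* **`S' ⊆ S_E ∪ S_d`** (`setOf_quadraticTwist_subset_union`): a group fixing `E[ℓ]` and `√d`
  fixes `E^{(d)}[ℓ]`;
* **`S_E ∪ S_d ⊆ S'` as soon as `S_E ≠ S_d`** (`union_subset_setOf_quadraticTwist`): if, say,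
  `u' ∈ S_d ∖ S_E`, then for `u ≤ u'` the group `Γ^u ⊇ Γ^{u'}` contains an element fixing `E[ℓ]`
  and moving `√d`, which acts on `E[ℓ] ≠ 0` as `+1 ≠ -1 = ε_d` (`ℓ` odd); for `u > u'`,
  `u ∈ S_E ∪ S_d` forces `u ∈ S_d ∖ S_E` (initial intervals) and the same applies; symmetrically
  for `u' ∈ S_E ∖ S_d` with an element moving `E[ℓ]` and fixing `√d`;
* so **`S' = S_E ∪ S_d = ` the larger of the two nested sets `S_E`, `S_d`**, and
  **`Sw_𝔓(V_ℓ E^{(d)}) = max (Sw_𝔓(V_ℓ E), 2 u_d)` whenever `Sw_𝔓(V_ℓ E) ≠ 2 u_d`**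
  (`swanConductorAt_rationalTate_quadraticTwist_eq_max`; both sets of finite measure, which in
  practice is read off the positivity of the two numbers); when `Sw_𝔓(V_ℓ E) = 2 u_d` only
  `Sw_𝔓(V_ℓ E^{(d)}) ≤ 2 u_d` survives (`…_le_of_subset`), the twisted break may drop.

The same in `E[ℓ]`-form (`swanConductorAt_torsion_quadraticTwist_eq_max_of_pos`, through
`Sw_𝔓(V_ℓ E) = Sw_𝔓(E[ℓ])`, `SwanConductorTorsionProofs`), and over `ℚ` at the place above `2`
with `d ∈ ℤ`: `Sw(E^{(d)}) = max (Sw(E), 2)` for `d ≡ 3 (mod 4)` and `= max (Sw(E), 4)` for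
`d ≡ 2 (mod 4)` (`Rat.swanConductorAt_rationalTate_quadraticTwist_eq_max_two_of_emod_four_eq_three`,
`…_four_of_emod_four_eq_two`), while `Sw(E^{(d)}) = Sw(E)` for `d ≡ 1 (mod 4)`
(`…_of_emod_four_eq_one`, `√d` is unramified at `2`).

## Use: the twist orbits of the non-abelian leaf over `ℚ`

For `E/ℚ` potentially good at `2` with `ord₂(j) > 0` and non-abelian inertia on `E[3]`, all curves
with the same `j` are quadratic twists of one another and `Sw_𝔓(E[3]) = 2 φ_{E_x/ℚ}(b)` with
`E_x = ℚ(x(E[3]))` depending on `j` only (`ThreeTorsionCentralInvolutionSwanProofs`).  The theorem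
propagates one base value along each twist orbit: e.g. `Sw = 3` for `y² = x³ - x` (type `III`,
`ord₂ Δ = 6`, `N = 32`) gives `Sw = max (3, 4) = 4` for its twists by `±2, ±6` (types `II`/`I₂*`,
`N = 64·…`), and `Sw = 1` on the `SL₂(𝔽₃)`-branch `(III, 4)` gives `2 = max (1, 2)` after `χ₋₁`
and `4 = max (1, 4)` after `χ_{±2}` — the rows `δ₂ = 1, 2, 4` of the `SL₂(𝔽₃)` world and
`δ₂ = 3, 4` of the quaternion world are single twist orbits, and only one explicit break per
`x`-field class remains to be computed (cf. the atlas in `ThreeTorsionRadicalsNormProofs`).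

## References

* J. H. Silverman, *Advanced Topics in the Arithmetic of Elliptic Curves*, GTM 151 (1994), §IV.10
  (Definition of `δ`, PDF p. 358; Thm. 10.2(b),(c) and proof, twist argument pp. 359–362),
  Thm. IV.11.1 (`p = 2`: p. 366; the upper-numbering computation p. 370). [SilvermanATAEC1994]
* J. H. Silverman, *The Arithmetic of Elliptic Curves*, 2nd ed. (2009), X.2 Prop. 2.4, X.5
  Cor. 5.4. [SilvermanAEC2009]
* J.-P. Serre, *Local Fields*, GTM 67 (1979), Ch. IV §3 (upper numbering, Remark 1), Ch. VI §2
  (Swan conductor). [SerreLocalFields1979]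

## Design

Theorems only; `noncomputable section`; `namespace WeierstrassCurve`; the sets `S_E, S_d, S'`
are written out as set-builder expressions (no definitions).  §1 is pointwise in `σ`, §2 is the
set identity, §3 the measure statement (elementary: two nested sets of finite measure), §4 the
Swan conductors, §5 the specialisation to `ℚ` and `2`.  Axioms: `propext`, `Classical.choice`,
`Quot.sound`.
-/

noncomputable section

open scoped Classical NumberField
open Field IsDedekindDomain MeasureTheory

universe u

namespace WeierstrassCurve

open Literature.NumberTheory.EllipticCurves Literature.NumberTheory.GaloisRepresentations

variable {K : Type u} [Field K] [NumberField K] (W : WeierstrassCurve K) (ℓ : ℕ) [Fact ℓ.Prime]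

/-! ## §1. Pointwise: how `σ` acts on `E^{(d)}[ℓ]` in terms of `E[ℓ]` and `√d` -/

omit [NumberField K] [Fact ℓ.Prime] in
/-- Along `f : E^{(d)}(K̄) ≃+ E(K̄)`, an `ℓ`-torsion point of the twist goes to an `ℓ`-torsion
point. [folklore] -/
theorem addEquiv_apply_mem_geomTorsion {d : K}
    (f : (W.quadraticTwist d).geomPoints ≃+ W.geomPoints)
    (T : geomTorsion (W.quadraticTwist d) ℓ) :
    f (T : (W.quadraticTwist d).geomPoints) ∈ geomTorsion W ℓ := by
  rw [AddSubgroup.torsionBy.nsmul_iff, ← map_nsmul,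
    AddSubgroup.torsionBy.nsmul_iff.mp T.2, map_zero]

omit [NumberField K] [Fact ℓ.Prime] in
/-- Along `f : E^{(d)}(K̄) ≃+ E(K̄)`, an `ℓ`-torsion point of `E` comes from an `ℓ`-torsion point
of the twist. [folklore] -/
theorem addEquiv_symm_apply_mem_geomTorsion {d : K}
    (f : (W.quadraticTwist d).geomPoints ≃+ W.geomPoints) (T : geomTorsion W ℓ) :
    f.symm (T : W.geomPoints) ∈ geomTorsion (W.quadraticTwist d) ℓ := by
  rw [AddSubgroup.torsionBy.nsmul_iff]
  apply f.injective
  rw [map_nsmul, AddEquiv.apply_symm_apply, map_zero]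
  exact AddSubgroup.torsionBy.nsmul_iff.mp T.2

omit [Fact ℓ.Prime] in
/-- **An element fixing `√d` and `E[ℓ]` fixes `E^{(d)}[ℓ]`.**  For `σ ∈ Γ_K` with `σ√d = √d` the
isomorphism `f : E^{(d)}(K̄) ≃ E(K̄)` is `σ`-equivariant (*AEC* X.5 Cor. 5.4,
`exists_addEquiv_geomPoints_quadraticTwist_sign`), so `σ` fixes `E^{(d)}[ℓ]` pointwise as soon as
it fixes `E[ℓ]` pointwise. [cite: SilvermanAEC2009, X.5 Cor. 5.4]
[cite: SilvermanATAEC1994, proof of Thm. IV.10.2(b), twist argument (PDF pp. 359–360)] -/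
theorem forall_smul_geomTorsion_quadraticTwist_eq_of_smul_geomSqrt_eq {d : K} (hd : d ≠ 0)
    {σ : absoluteGaloisGroup K} (hσd : σ • geomSqrt d = geomSqrt d)
    (hσE : ∀ T : geomTorsion W ℓ, σ • T = T) :
    ∀ T : geomTorsion (W.quadraticTwist d) ℓ, σ • T = T := by
  obtain ⟨f, hfpos, -⟩ := W.exists_addEquiv_geomPoints_quadraticTwist_sign hd
  intro T
  apply Subtype.ext
  apply f.injective
  change f (σ • (T : (W.quadraticTwist d).geomPoints)) = f T
  rw [hfpos σ hσd]
  exact congrArg Subtype.val (hσE ⟨f T, W.addEquiv_apply_mem_geomTorsion ℓ f T⟩)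

omit [Fact ℓ.Prime] in
/-- **An element fixing `√d` and moving `E[ℓ]` moves `E^{(d)}[ℓ]`** (same equivariance).
[cite: SilvermanAEC2009, X.5 Cor. 5.4] -/
theorem exists_smul_geomTorsion_quadraticTwist_ne_of_smul_geomSqrt_eq {d : K} (hd : d ≠ 0)
    {σ : absoluteGaloisGroup K} (hσd : σ • geomSqrt d = geomSqrt d)
    (hσE : ∃ T : geomTorsion W ℓ, σ • T ≠ T) :
    ∃ T : geomTorsion (W.quadraticTwist d) ℓ, σ • T ≠ T := by
  obtain ⟨f, hfpos, -⟩ := W.exists_addEquiv_geomPoints_quadraticTwist_sign hd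
  obtain ⟨T, hT⟩ := hσE
  refine ⟨⟨f.symm (T : W.geomPoints), W.addEquiv_symm_apply_mem_geomTorsion ℓ f T⟩, fun h ↦ hT ?_⟩
  apply Subtype.ext
  have h' := congrArg (fun P : geomTorsion (W.quadraticTwist d) ℓ ↦
    f (P : (W.quadraticTwist d).geomPoints)) h
  simp only at h'
  change f (σ • f.symm (T : W.geomPoints)) = f (f.symm (T : W.geomPoints)) at h'
  rw [hfpos σ hσd, AddEquiv.apply_symm_apply] at h'
  exact h'

/-- **An element moving `√d` and fixing `E[ℓ]` moves `E^{(d)}[ℓ]`, `ℓ` odd.**  If `σ√d = -√d`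
then `f(σP) = -σf(P)`; for a non-zero `T ∈ E^{(d)}[ℓ]` (there is one: `#E[ℓ] = ℓ²`,
`card_torsionPoints_eq_sq_holds`) with `σT = T` this would give `f(T) = -f(T)`, `2f(T) = 0`,
and with `ℓ f(T) = 0`, `ℓ` odd, `f(T) = 0` (`eq_zero_of_odd_of_smul_eq_zero`), a contradiction.
[cite: SilvermanAEC2009, X.5 Cor. 5.4]
[cite: SilvermanATAEC1994, proof of Thm. IV.10.2(b), twist argument (PDF pp. 359–360)] -/
theorem exists_smul_geomTorsion_quadraticTwist_ne_of_smul_geomSqrt_ne [W.IsElliptic]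
    (hℓ2 : ℓ ≠ 2) {d : K} (hd : d ≠ 0)
    {σ : absoluteGaloisGroup K} (hσd : σ • geomSqrt d ≠ geomSqrt d)
    (hσE : ∀ T : geomTorsion W ℓ, σ • T = T) :
    ∃ T : geomTorsion (W.quadraticTwist d) ℓ, σ • T ≠ T := by
  haveI : (W.quadraticTwist d).IsElliptic := W.isElliptic_quadraticTwist hd
  obtain ⟨f, -, hfneg⟩ := W.exists_addEquiv_geomPoints_quadraticTwist_sign hd
  have hneg : σ • geomSqrt d = -geomSqrt d :=
    (map_geomSqrt (absoluteGaloisGroup.toAlgEquiv K σ) d).resolve_left hσd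
  -- a non-zero `ℓ`-torsion point of the twist
  have hcard : Nat.card (geomTorsion (W.quadraticTwist d) ℓ) = ℓ ^ 2 :=
    card_torsionPoints_eq_sq_holds (W.quadraticTwist d) (AlgebraicClosure K) (n := ℓ)
      (by exact_mod_cast (Fact.out : ℓ.Prime).ne_zero)
  haveI : Finite (geomTorsion (W.quadraticTwist d) ℓ) := Nat.finite_of_card_ne_zero (by
    rw [hcard]; exact pow_ne_zero 2 (Fact.out : ℓ.Prime).ne_zero)
  have hnt : Nontrivial (geomTorsion (W.quadraticTwist d) ℓ) := by
    rw [← Finite.one_lt_card_iff_nontrivial, hcard]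
    exact Nat.one_lt_pow two_ne_zero (Fact.out : ℓ.Prime).one_lt
  obtain ⟨T, hT0⟩ := exists_ne (0 : geomTorsion (W.quadraticTwist d) ℓ)
  refine ⟨T, fun hσT ↦ hT0 ?_⟩
  -- `f T` is `ℓ`-torsion and fixed by `σ`
  set Q : geomTorsion W ℓ := ⟨f (T : (W.quadraticTwist d).geomPoints),
    W.addEquiv_apply_mem_geomTorsion ℓ f T⟩ with hQ
  have hσQ : σ • f (T : (W.quadraticTwist d).geomPoints) = f T :=
    congrArg Subtype.val (hσE Q)
  -- `f (σ T) = - σ f T`, i.e. `f T = - f T`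
  have h1 := hfneg σ hneg (T : (W.quadraticTwist d).geomPoints)
  have hσT' : σ • (T : (W.quadraticTwist d).geomPoints) = T := congrArg Subtype.val hσT
  rw [hσT', hσQ] at h1
  -- so `2 f T = 0` and `ℓ f T = 0` with `ℓ` odd: `f T = 0`
  have h2 : (2 : ℤ) • f (T : (W.quadraticTwist d).geomPoints) = 0 := by
    rw [two_zsmul]
    nth_rewrite 2 [h1]
    rw [add_neg_cancel]
  have hℓ' : (ℓ : ℤ) • f (T : (W.quadraticTwist d).geomPoints) = 0 := by
    rw [natCast_zsmul]
    exact AddSubgroup.torsionBy.nsmul_iff.mp (W.addEquiv_apply_mem_geomTorsion ℓ f T)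
  have h0 : f (T : (W.quadraticTwist d).geomPoints) = 0 :=
    eq_zero_of_odd_of_smul_eq_zero ((Fact.out : ℓ.Prime).odd_of_ne_two hℓ2) hℓ' h2
  apply Subtype.ext
  apply f.injective
  rw [h0]
  exact (map_zero f).symm

/-! ## §2. The set identity `S' = S_E ∪ S_d` -/

omit [Fact ℓ.Prime] in
/-- **`S' ⊆ S_E ∪ S_d`**: if `Γ_K^u(𝔓)` moves `E^{(d)}[ℓ]` then it moves `E[ℓ]` or `√d`.
[cite: SilvermanATAEC1994, proof of Thm. IV.10.2(b), twist argument (PDF pp. 359–360)] -/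
theorem setOf_quadraticTwist_subset_union {d : K} (hd : d ≠ 0)
    (𝔓 : Ideal (absIntegers (𝓞 K) K)) :
    {u : ℝ | 0 < u ∧ ∃ σ ∈ absUpperRamificationSubgroup (𝓞 K) 𝔓 u,
        ∃ T : geomTorsion (W.quadraticTwist d) ℓ, σ • T ≠ T} ⊆
      {u : ℝ | 0 < u ∧ ∃ σ ∈ absUpperRamificationSubgroup (𝓞 K) 𝔓 u,
        ∃ T : geomTorsion W ℓ, σ • T ≠ T} ∪
      {u : ℝ | 0 < u ∧ ∃ σ ∈ absUpperRamificationSubgroup (𝓞 K) 𝔓 u,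
        σ • geomSqrt d ≠ geomSqrt d} := by
  rintro u ⟨hu, σ, hσ, T, hT⟩
  by_contra hno
  simp only [Set.mem_union, Set.mem_setOf_eq, not_or, not_and, not_exists] at hno
  have hE : ∀ T : geomTorsion W ℓ, σ • T = T := fun T ↦ by
    by_contra h; exact hno.1 hu σ hσ T h
  have hD : σ • geomSqrt d = geomSqrt d := by
    by_contra h; exact hno.2 hu σ hσ h
  exact hT (W.forall_smul_geomTorsion_quadraticTwist_eq_of_smul_geomSqrt_eq ℓ hd hD hE T)

omit [NumberField K] in
/-- If `Γ_K^{u'}(𝔓)` moves `√d` then so does `Γ_K^u(𝔓)` for `u ≤ u'` (the filtration is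
decreasing). [cite: SerreLocalFields1979, Ch. IV §3 Remark 1] -/
theorem exists_smul_geomSqrt_ne_of_le {d : K} {𝔓 : Ideal (absIntegers (𝓞 K) K)} {u u' : ℝ}
    (huu' : u ≤ u')
    (h : ∃ σ ∈ absUpperRamificationSubgroup (𝓞 K) 𝔓 u', σ • geomSqrt d ≠ geomSqrt d) :
    ∃ σ ∈ absUpperRamificationSubgroup (𝓞 K) 𝔓 u, σ • geomSqrt d ≠ geomSqrt d := by
  obtain ⟨σ, hσ, hne⟩ := h
  exact ⟨σ, absUpperRamificationSubgroup_antitone_holds (𝓞 K) 𝔓 huu' hσ, hne⟩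

/-- **`S_d ∖ S_E ⊆ S'`, `ℓ` odd**: a `u > 0` at which `Γ^u` moves `√d` but fixes `E[ℓ]` lies in
`S'` (an element moving `√d` and fixing `E[ℓ]` moves `E^{(d)}[ℓ]`).
[cite: SilvermanATAEC1994, proof of Thm. IV.10.2(b), twist argument (PDF pp. 359–360)] -/
theorem mem_setOf_quadraticTwist_of_sqrt_of_not [W.IsElliptic] (hℓ2 : ℓ ≠ 2) {d : K} (hd : d ≠ 0)
    {𝔓 : Ideal (absIntegers (𝓞 K) K)} {u : ℝ} (hu : 0 < u)
    (hD : ∃ σ ∈ absUpperRamificationSubgroup (𝓞 K) 𝔓 u, σ • geomSqrt d ≠ geomSqrt d)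
    (hE : ¬ ∃ σ ∈ absUpperRamificationSubgroup (𝓞 K) 𝔓 u, ∃ T : geomTorsion W ℓ, σ • T ≠ T) :
    u ∈ {u : ℝ | 0 < u ∧ ∃ σ ∈ absUpperRamificationSubgroup (𝓞 K) 𝔓 u,
        ∃ T : geomTorsion (W.quadraticTwist d) ℓ, σ • T ≠ T} := by
  obtain ⟨σ, hσ, hσd⟩ := hD
  push Not at hE
  exact ⟨hu, σ, hσ, W.exists_smul_geomTorsion_quadraticTwist_ne_of_smul_geomSqrt_ne ℓ hℓ2 hd hσd
    (hE σ hσ)⟩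

omit [Fact ℓ.Prime] in
/-- **`S_E ∖ S_d ⊆ S'`**: a `u > 0` at which `Γ^u` moves `E[ℓ]` but fixes `√d` lies in `S'`.
[cite: SilvermanATAEC1994, proof of Thm. IV.10.2(b), twist argument (PDF pp. 359–360)] -/
theorem mem_setOf_quadraticTwist_of_torsion_of_not {d : K} (hd : d ≠ 0)
    {𝔓 : Ideal (absIntegers (𝓞 K) K)} {u : ℝ} (hu : 0 < u)
    (hE : ∃ σ ∈ absUpperRamificationSubgroup (𝓞 K) 𝔓 u, ∃ T : geomTorsion W ℓ, σ • T ≠ T)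
    (hD : ¬ ∃ σ ∈ absUpperRamificationSubgroup (𝓞 K) 𝔓 u, σ • geomSqrt d ≠ geomSqrt d) :
    u ∈ {u : ℝ | 0 < u ∧ ∃ σ ∈ absUpperRamificationSubgroup (𝓞 K) 𝔓 u,
        ∃ T : geomTorsion (W.quadraticTwist d) ℓ, σ • T ≠ T} := by
  obtain ⟨σ, hσ, T, hT⟩ := hE
  push Not at hD
  exact ⟨hu, σ, hσ, W.exists_smul_geomTorsion_quadraticTwist_ne_of_smul_geomSqrt_eq ℓ hd (hD σ hσ)
    ⟨T, hT⟩⟩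

/-- **`S_E ∪ S_d ⊆ S'` when `S_E ≠ S_d`** (`ℓ` odd).  Let `u' ` lie in one of `S_E, S_d` and not
in the other, say `u' ∈ S_d ∖ S_E` (the other case is symmetric).  For `u ∈ S_E ∪ S_d`: if
`u ≤ u'` then `u' ∈ S'` (`mem_setOf_quadraticTwist_of_sqrt_of_not`) and `S'` is an initial
interval (`exists_smul_geomTorsion_ne_of_le`); if `u' < u` then `u ∉ S_E` (initial interval), so
`u ∈ S_d ∖ S_E ⊆ S'`.
[cite: SilvermanATAEC1994, proof of Thm. IV.10.2(b),(c), twist argument (PDF pp. 359–362)]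
[cite: SerreLocalFields1979, Ch. IV §3 Remark 1] -/
theorem union_subset_setOf_quadraticTwist [W.IsElliptic] (hℓ2 : ℓ ≠ 2) {d : K} (hd : d ≠ 0)
    (𝔓 : Ideal (absIntegers (𝓞 K) K))
    (hne : {u : ℝ | 0 < u ∧ ∃ σ ∈ absUpperRamificationSubgroup (𝓞 K) 𝔓 u,
        ∃ T : geomTorsion W ℓ, σ • T ≠ T} ≠
      {u : ℝ | 0 < u ∧ ∃ σ ∈ absUpperRamificationSubgroup (𝓞 K) 𝔓 u,
        σ • geomSqrt d ≠ geomSqrt d}) :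
    {u : ℝ | 0 < u ∧ ∃ σ ∈ absUpperRamificationSubgroup (𝓞 K) 𝔓 u,
        ∃ T : geomTorsion W ℓ, σ • T ≠ T} ∪
      {u : ℝ | 0 < u ∧ ∃ σ ∈ absUpperRamificationSubgroup (𝓞 K) 𝔓 u,
        σ • geomSqrt d ≠ geomSqrt d} ⊆
      {u : ℝ | 0 < u ∧ ∃ σ ∈ absUpperRamificationSubgroup (𝓞 K) 𝔓 u,
        ∃ T : geomTorsion (W.quadraticTwist d) ℓ, σ • T ≠ T} := by
  set SE : Set ℝ := {u : ℝ | 0 < u ∧ ∃ σ ∈ absUpperRamificationSubgroup (𝓞 K) 𝔓 u,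
    ∃ T : geomTorsion W ℓ, σ • T ≠ T} with hSE
  set SD : Set ℝ := {u : ℝ | 0 < u ∧ ∃ σ ∈ absUpperRamificationSubgroup (𝓞 K) 𝔓 u,
    σ • geomSqrt d ≠ geomSqrt d} with hSD
  set S' : Set ℝ := {u : ℝ | 0 < u ∧ ∃ σ ∈ absUpperRamificationSubgroup (𝓞 K) 𝔓 u,
    ∃ T : geomTorsion (W.quadraticTwist d) ℓ, σ • T ≠ T} with hS'
  -- `S'` is an initial interval
  have hS'down : ∀ {u u' : ℝ}, 0 < u → u ≤ u' → u' ∈ S' → u ∈ S' := fun hu huu' hu' ↦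
    ⟨hu, (W.quadraticTwist d).exists_smul_geomTorsion_ne_of_le ℓ huu' hu'.2⟩
  -- an element of the symmetric difference
  obtain ⟨u', hu'⟩ : ∃ u', (u' ∈ SD ∧ u' ∉ SE) ∨ (u' ∈ SE ∧ u' ∉ SD) := by
    by_contra hall
    push Not at hall
    exact hne (Set.ext fun x ↦ ⟨fun hx ↦ (hall x).2 hx, fun hx ↦ (hall x).1 hx⟩)
  intro u hu
  have hu0 : 0 < u := hu.elim (fun h ↦ h.1) (fun h ↦ h.1)
  rcases hu' with ⟨hu'D, hu'E⟩ | ⟨hu'E, hu'D⟩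
  · -- `u' ∈ S_d ∖ S_E`
    have hu'S : u' ∈ S' := W.mem_setOf_quadraticTwist_of_sqrt_of_not ℓ hℓ2 hd hu'D.1 hu'D.2
      (fun h ↦ hu'E ⟨hu'D.1, h⟩)
    by_cases huu' : u ≤ u'
    · exact hS'down hu0 huu' hu'S
    · push Not at huu'
      -- `u ∉ S_E` (else `u' ∈ S_E`), hence `u ∈ S_d ∖ S_E`
      have huE : ¬ ∃ σ ∈ absUpperRamificationSubgroup (𝓞 K) 𝔓 u,
          ∃ T : geomTorsion W ℓ, σ • T ≠ T := fun h ↦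
        hu'E ⟨hu'D.1, W.exists_smul_geomTorsion_ne_of_le ℓ huu'.le h⟩
      have huD : u ∈ SD := by
        rcases hu with h | h
        · exact absurd h.2 huE
        · exact h
      exact W.mem_setOf_quadraticTwist_of_sqrt_of_not ℓ hℓ2 hd hu0 huD.2 huE
  · -- `u' ∈ S_E ∖ S_d`
    have hu'S : u' ∈ S' := W.mem_setOf_quadraticTwist_of_torsion_of_not ℓ hd hu'E.1 hu'E.2
      (fun h ↦ hu'D ⟨hu'E.1, h⟩)
    by_cases huu' : u ≤ u'
    · exact hS'down hu0 huu' hu'S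
    · push Not at huu'
      have huD : ¬ ∃ σ ∈ absUpperRamificationSubgroup (𝓞 K) 𝔓 u,
          σ • geomSqrt d ≠ geomSqrt d := fun h ↦
        hu'D ⟨hu'E.1, exists_smul_geomSqrt_ne_of_le huu'.le h⟩
      have huE : u ∈ SE := by
        rcases hu with h | h
        · exact h
        · exact absurd h.2 huD
      exact W.mem_setOf_quadraticTwist_of_torsion_of_not ℓ hd hu0 huE.2 huD

/-- **`S' = S_E ∪ S_d` when `S_E ≠ S_d`** (`ℓ` odd): the set of `u > 0` at which `Γ_K^u(𝔓)`
moves `E^{(d)}[ℓ]` is the union of the sets at which it moves `E[ℓ]`, resp. `√d`, unless these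
two coincide. [cite: SilvermanATAEC1994, proof of Thm. IV.10.2(b),(c), twist argument (PDF pp. 359–362)]
[cite: SerreLocalFields1979, Ch. IV §3 Remark 1] -/
theorem setOf_quadraticTwist_eq_union [W.IsElliptic] (hℓ2 : ℓ ≠ 2) {d : K} (hd : d ≠ 0)
    (𝔓 : Ideal (absIntegers (𝓞 K) K))
    (hne : {u : ℝ | 0 < u ∧ ∃ σ ∈ absUpperRamificationSubgroup (𝓞 K) 𝔓 u,
        ∃ T : geomTorsion W ℓ, σ • T ≠ T} ≠
      {u : ℝ | 0 < u ∧ ∃ σ ∈ absUpperRamificationSubgroup (𝓞 K) 𝔓 u,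
        σ • geomSqrt d ≠ geomSqrt d}) :
    {u : ℝ | 0 < u ∧ ∃ σ ∈ absUpperRamificationSubgroup (𝓞 K) 𝔓 u,
        ∃ T : geomTorsion (W.quadraticTwist d) ℓ, σ • T ≠ T} =
      {u : ℝ | 0 < u ∧ ∃ σ ∈ absUpperRamificationSubgroup (𝓞 K) 𝔓 u,
        ∃ T : geomTorsion W ℓ, σ • T ≠ T} ∪
      {u : ℝ | 0 < u ∧ ∃ σ ∈ absUpperRamificationSubgroup (𝓞 K) 𝔓 u,
        σ • geomSqrt d ≠ geomSqrt d} :=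
  Set.Subset.antisymm (W.setOf_quadraticTwist_subset_union ℓ hd 𝔓)
    (W.union_subset_setOf_quadraticTwist ℓ hℓ2 hd 𝔓 hne)

omit [NumberField K] [Fact ℓ.Prime] in
/-- **`S_E ⊆ S_d` or `S_d ⊆ S_E`**: two initial intervals of `(0, ∞)` are nested.
[cite: SerreLocalFields1979, Ch. IV §3 Remark 1] -/
theorem setOf_torsion_subset_or_subset {d : K} (𝔓 : Ideal (absIntegers (𝓞 K) K)) :
    {u : ℝ | 0 < u ∧ ∃ σ ∈ absUpperRamificationSubgroup (𝓞 K) 𝔓 u,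
        ∃ T : geomTorsion W ℓ, σ • T ≠ T} ⊆
      {u : ℝ | 0 < u ∧ ∃ σ ∈ absUpperRamificationSubgroup (𝓞 K) 𝔓 u,
        σ • geomSqrt d ≠ geomSqrt d} ∨
    {u : ℝ | 0 < u ∧ ∃ σ ∈ absUpperRamificationSubgroup (𝓞 K) 𝔓 u,
        σ • geomSqrt d ≠ geomSqrt d} ⊆
      {u : ℝ | 0 < u ∧ ∃ σ ∈ absUpperRamificationSubgroup (𝓞 K) 𝔓 u,
        ∃ T : geomTorsion W ℓ, σ • T ≠ T} := by
  by_contra h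
  push Not at h
  obtain ⟨⟨a, haE, haD⟩, ⟨b, hbD, hbE⟩⟩ := Set.not_subset.mp h.1, Set.not_subset.mp h.2
  rcases le_total a b with hab | hba
  · exact haD ⟨haE.1, exists_smul_geomSqrt_ne_of_le hab hbD.2⟩
  · exact hbE ⟨hbD.1, W.exists_smul_geomTorsion_ne_of_le ℓ hba haE.2⟩

/-! ## §3. Measures: two nested sets of finite measure -/

omit [NumberField K] [Fact ℓ.Prime] in
/-- For nested sets of finite measure, the measure of the union is the larger measure.
[folklore] -/
theorem _root_.Literature.NumberTheory.EllipticCurves.measureReal_union_eq_max_of_subset_or_subset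
    {s t : Set ℝ} (h : s ⊆ t ∨ t ⊆ s) (hs : volume s ≠ ⊤) (ht : volume t ≠ ⊤) :
    volume.real (s ∪ t) = max (volume.real s) (volume.real t) := by
  rcases h with h | h
  · rw [Set.union_eq_self_of_subset_left h, max_eq_right (measureReal_mono h ht)]
  · rw [Set.union_eq_self_of_subset_right h, max_eq_left (measureReal_mono h hs)]

/-- **`vol S' = max (vol S_E, vol S_d)`** when `S_E ≠ S_d` have finite measure (`ℓ` odd).
[cite: SilvermanATAEC1994, proof of Thm. IV.10.2(b),(c) (PDF pp. 359–362)]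
[cite: SerreLocalFields1979, Ch. IV §3 Remark 1] -/
theorem volume_real_setOf_quadraticTwist_eq_max [W.IsElliptic] (hℓ2 : ℓ ≠ 2) {d : K} (hd : d ≠ 0)
    (𝔓 : Ideal (absIntegers (𝓞 K) K))
    (hfinE : volume {u : ℝ | 0 < u ∧ ∃ σ ∈ absUpperRamificationSubgroup (𝓞 K) 𝔓 u,
        ∃ T : geomTorsion W ℓ, σ • T ≠ T} ≠ ⊤)
    (hfinD : volume {u : ℝ | 0 < u ∧ ∃ σ ∈ absUpperRamificationSubgroup (𝓞 K) 𝔓 u,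
        σ • geomSqrt d ≠ geomSqrt d} ≠ ⊤)
    (hne : {u : ℝ | 0 < u ∧ ∃ σ ∈ absUpperRamificationSubgroup (𝓞 K) 𝔓 u,
        ∃ T : geomTorsion W ℓ, σ • T ≠ T} ≠
      {u : ℝ | 0 < u ∧ ∃ σ ∈ absUpperRamificationSubgroup (𝓞 K) 𝔓 u,
        σ • geomSqrt d ≠ geomSqrt d}) :
    volume.real {u : ℝ | 0 < u ∧ ∃ σ ∈ absUpperRamificationSubgroup (𝓞 K) 𝔓 u,
        ∃ T : geomTorsion (W.quadraticTwist d) ℓ, σ • T ≠ T} =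
      max (volume.real {u : ℝ | 0 < u ∧ ∃ σ ∈ absUpperRamificationSubgroup (𝓞 K) 𝔓 u,
          ∃ T : geomTorsion W ℓ, σ • T ≠ T})
        (volume.real {u : ℝ | 0 < u ∧ ∃ σ ∈ absUpperRamificationSubgroup (𝓞 K) 𝔓 u,
          σ • geomSqrt d ≠ geomSqrt d}) := by
  rw [W.setOf_quadraticTwist_eq_union ℓ hℓ2 hd 𝔓 hne]
  exact measureReal_union_eq_max_of_subset_or_subset (W.setOf_torsion_subset_or_subset ℓ 𝔓)
    hfinE hfinD

omit [NumberField K] [Fact ℓ.Prime] in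
/-- Unequal real measures come from unequal sets. [folklore] -/
theorem _root_.Literature.NumberTheory.EllipticCurves.setOf_ne_of_volume_real_ne {s t : Set ℝ}
    (h : volume.real s ≠ volume.real t) : s ≠ t :=
  fun hst ↦ h (by rw [hst])

omit [NumberField K] [Fact ℓ.Prime] in
/-- A set of positive real measure has finite measure. [folklore] -/
theorem _root_.Literature.NumberTheory.EllipticCurves.volume_ne_top_of_volume_real_pos {s : Set ℝ}
    (h : 0 < volume.real s) : volume s ≠ ⊤ :=
  (ENNReal.toReal_pos_iff.mp h).2.ne

/-! ## §4. The Swan conductors -/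

omit [Fact ℓ.Prime] in
/-- **`Sw_𝔓(V_ℓ E^{(d)}) ≤ Sw_𝔓(V_ℓ E) ⊔ 2 u_d` in the form `S' ⊆ S_E ∪ S_d`, measured**: with
both sets of finite measure, `vol S' ≤ max (vol S_E, vol S_d)` — valid also when `S_E = S_d`
(where the twisted break may drop). [cite: SilvermanATAEC1994, proof of Thm. IV.10.2(b),(c) (PDF pp. 359–362)] -/
theorem volume_real_setOf_quadraticTwist_le_max {d : K} (hd : d ≠ 0)
    (𝔓 : Ideal (absIntegers (𝓞 K) K))
    (hfinE : volume {u : ℝ | 0 < u ∧ ∃ σ ∈ absUpperRamificationSubgroup (𝓞 K) 𝔓 u,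
        ∃ T : geomTorsion W ℓ, σ • T ≠ T} ≠ ⊤)
    (hfinD : volume {u : ℝ | 0 < u ∧ ∃ σ ∈ absUpperRamificationSubgroup (𝓞 K) 𝔓 u,
        σ • geomSqrt d ≠ geomSqrt d} ≠ ⊤) :
    volume.real {u : ℝ | 0 < u ∧ ∃ σ ∈ absUpperRamificationSubgroup (𝓞 K) 𝔓 u,
        ∃ T : geomTorsion (W.quadraticTwist d) ℓ, σ • T ≠ T} ≤
      max (volume.real {u : ℝ | 0 < u ∧ ∃ σ ∈ absUpperRamificationSubgroup (𝓞 K) 𝔓 u,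
          ∃ T : geomTorsion W ℓ, σ • T ≠ T})
        (volume.real {u : ℝ | 0 < u ∧ ∃ σ ∈ absUpperRamificationSubgroup (𝓞 K) 𝔓 u,
          σ • geomSqrt d ≠ geomSqrt d}) := by
  rw [← measureReal_union_eq_max_of_subset_or_subset (W.setOf_torsion_subset_or_subset ℓ 𝔓)
    hfinE hfinD]
  exact measureReal_mono (W.setOf_quadraticTwist_subset_union ℓ hd 𝔓)
    (measure_union_ne_top hfinE hfinD)

/-- **The wild conductor of a quadratic twist.**  Let `E/K` be elliptic over a number field, `ℓ`
an odd prime, `v ∤ ℓ`, `𝔓 ∣ v`, `d ≠ 0`, and `u_d = vol {u > 0 : Γ_K^u(𝔓) moves √d}` (the upper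
break of `K(√d)` at `𝔓`).  If `Sw_𝔓(V_ℓ E) ≠ 2 u_d` and both are read off sets of finite measure,
then **`Sw_𝔓(V_ℓ E^{(d)}) = max (Sw_𝔓(V_ℓ E), 2 u_d)`**: `Sw = 2 · vol` of the corresponding
sets (`swanConductorAt_rationalTate_eq_two_mul_volume`) and `S' = S_E ∪ S_d` is the larger of two
nested sets (`volume_real_setOf_quadraticTwist_eq_max`).  This is the twist argument of Silverman
*ATAEC* Thm. IV.10.2(b)–(c) with the sign kept, in the upper numbering of p. 370.
[cite: SilvermanATAEC1994, Thm. IV.10.2(b),(c) and proof (PDF pp. 358–362); proof of Thm. IV.11.1 (p. 370)]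
[cite: SerreLocalFields1979, Ch. IV §3 Remark 1, Ch. VI §2] -/
theorem swanConductorAt_rationalTate_quadraticTwist_eq_max [W.IsElliptic] (hℓ2 : ℓ ≠ 2)
    {d : K} (hd : d ≠ 0)
    (h : Continuous fun x : absoluteGaloisGroup K × RationalTateModule (geomPoints W) ℓ ↦
      rationalTateRepresentation (absoluteGaloisGroup K) (geomPoints W) ℓ x.1 x.2)
    (h' : Continuous fun x : absoluteGaloisGroup K ×
        RationalTateModule (geomPoints (W.quadraticTwist d)) ℓ ↦
      rationalTateRepresentation (absoluteGaloisGroup K) (geomPoints (W.quadraticTwist d)) ℓ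
        x.1 x.2)
    {v : HeightOneSpectrum (𝓞 K)} (hℓ : (ℓ : 𝓞 K) ∉ v.asIdeal)
    {𝔓 : Ideal (absIntegers (𝓞 K) K)} (h𝔓 : 𝔓 ∈ v.primesAbove)
    (hfinE : volume {u : ℝ | 0 < u ∧ ∃ σ ∈ absUpperRamificationSubgroup (𝓞 K) 𝔓 u,
        ∃ T : geomTorsion W ℓ, σ • T ≠ T} ≠ ⊤)
    (hfinD : volume {u : ℝ | 0 < u ∧ ∃ σ ∈ absUpperRamificationSubgroup (𝓞 K) 𝔓 u,
        σ • geomSqrt d ≠ geomSqrt d} ≠ ⊤)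
    (hne : (rationalTateGaloisRepOf (geomPoints W) ℓ h).swanConductorAt (𝓞 K) 𝔓 ≠
      2 * volume.real {u : ℝ | 0 < u ∧ ∃ σ ∈ absUpperRamificationSubgroup (𝓞 K) 𝔓 u,
        σ • geomSqrt d ≠ geomSqrt d}) :
    (rationalTateGaloisRepOf (geomPoints (W.quadraticTwist d)) ℓ h').swanConductorAt (𝓞 K) 𝔓 =
      max ((rationalTateGaloisRepOf (geomPoints W) ℓ h).swanConductorAt (𝓞 K) 𝔓)
        (2 * volume.real {u : ℝ | 0 < u ∧ ∃ σ ∈ absUpperRamificationSubgroup (𝓞 K) 𝔓 u,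
          σ • geomSqrt d ≠ geomSqrt d}) := by
  haveI := W.isElliptic_quadraticTwist hd
  rw [W.swanConductorAt_rationalTate_eq_two_mul_volume ℓ h hℓ h𝔓] at hne ⊢
  rw [(W.quadraticTwist d).swanConductorAt_rationalTate_eq_two_mul_volume ℓ h' hℓ h𝔓,
    W.volume_real_setOf_quadraticTwist_eq_max ℓ hℓ2 hd 𝔓 hfinE hfinD
      (setOf_ne_of_volume_real_ne fun heq ↦ hne (by rw [heq])),
    mul_max_of_nonneg _ _ (by norm_num : (0 : ℝ) ≤ 2)]

/-- **The wild conductor of a quadratic twist, upper bound** (no hypothesis `Sw ≠ 2u_d`):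
`Sw_𝔓(V_ℓ E^{(d)}) ≤ max (Sw_𝔓(V_ℓ E), 2 u_d)`. [cite: SilvermanATAEC1994, Thm. IV.10.2(b),(c) and proof (PDF pp. 358–362)]
[cite: SerreLocalFields1979, Ch. IV §3 Remark 1, Ch. VI §2] -/
theorem swanConductorAt_rationalTate_quadraticTwist_le_max [W.IsElliptic] {d : K} (hd : d ≠ 0)
    (h : Continuous fun x : absoluteGaloisGroup K × RationalTateModule (geomPoints W) ℓ ↦
      rationalTateRepresentation (absoluteGaloisGroup K) (geomPoints W) ℓ x.1 x.2)
    (h' : Continuous fun x : absoluteGaloisGroup K ×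
        RationalTateModule (geomPoints (W.quadraticTwist d)) ℓ ↦
      rationalTateRepresentation (absoluteGaloisGroup K) (geomPoints (W.quadraticTwist d)) ℓ
        x.1 x.2)
    {v : HeightOneSpectrum (𝓞 K)} (hℓ : (ℓ : 𝓞 K) ∉ v.asIdeal)
    {𝔓 : Ideal (absIntegers (𝓞 K) K)} (h𝔓 : 𝔓 ∈ v.primesAbove)
    (hfinE : volume {u : ℝ | 0 < u ∧ ∃ σ ∈ absUpperRamificationSubgroup (𝓞 K) 𝔓 u,
        ∃ T : geomTorsion W ℓ, σ • T ≠ T} ≠ ⊤)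
    (hfinD : volume {u : ℝ | 0 < u ∧ ∃ σ ∈ absUpperRamificationSubgroup (𝓞 K) 𝔓 u,
        σ • geomSqrt d ≠ geomSqrt d} ≠ ⊤) :
    (rationalTateGaloisRepOf (geomPoints (W.quadraticTwist d)) ℓ h').swanConductorAt (𝓞 K) 𝔓 ≤
      max ((rationalTateGaloisRepOf (geomPoints W) ℓ h).swanConductorAt (𝓞 K) 𝔓)
        (2 * volume.real {u : ℝ | 0 < u ∧ ∃ σ ∈ absUpperRamificationSubgroup (𝓞 K) 𝔓 u,
          σ • geomSqrt d ≠ geomSqrt d}) := by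
  haveI := W.isElliptic_quadraticTwist hd
  rw [W.swanConductorAt_rationalTate_eq_two_mul_volume ℓ h hℓ h𝔓,
    (W.quadraticTwist d).swanConductorAt_rationalTate_eq_two_mul_volume ℓ h' hℓ h𝔓,
    ← mul_max_of_nonneg _ _ (by norm_num : (0 : ℝ) ≤ 2)]
  exact mul_le_mul_of_nonneg_left (W.volume_real_setOf_quadraticTwist_le_max ℓ hd 𝔓 hfinE hfinD)
    (by norm_num)

/-- **The same when the two numbers are positive** (the usual way finiteness of the two sets is
known, a set of positive real measure having finite measure): for `0 < Sw_𝔓(V_ℓ E)`, `0 < u_d`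
and `Sw_𝔓(V_ℓ E) ≠ 2 u_d`, `Sw_𝔓(V_ℓ E^{(d)}) = max (Sw_𝔓(V_ℓ E), 2 u_d)`.
[cite: SilvermanATAEC1994, Thm. IV.10.2(b),(c) and proof (PDF pp. 358–362); proof of Thm. IV.11.1 (p. 370)]
[cite: SerreLocalFields1979, Ch. IV §3 Remark 1, Ch. VI §2] -/
theorem swanConductorAt_rationalTate_quadraticTwist_eq_max_of_pos [W.IsElliptic] (hℓ2 : ℓ ≠ 2)
    {d : K} (hd : d ≠ 0)
    (h : Continuous fun x : absoluteGaloisGroup K × RationalTateModule (geomPoints W) ℓ ↦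
      rationalTateRepresentation (absoluteGaloisGroup K) (geomPoints W) ℓ x.1 x.2)
    (h' : Continuous fun x : absoluteGaloisGroup K ×
        RationalTateModule (geomPoints (W.quadraticTwist d)) ℓ ↦
      rationalTateRepresentation (absoluteGaloisGroup K) (geomPoints (W.quadraticTwist d)) ℓ
        x.1 x.2)
    {v : HeightOneSpectrum (𝓞 K)} (hℓ : (ℓ : 𝓞 K) ∉ v.asIdeal)
    {𝔓 : Ideal (absIntegers (𝓞 K) K)} (h𝔓 : 𝔓 ∈ v.primesAbove)
    (hposE : 0 < (rationalTateGaloisRepOf (geomPoints W) ℓ h).swanConductorAt (𝓞 K) 𝔓)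
    (hposD : 0 < volume.real {u : ℝ | 0 < u ∧ ∃ σ ∈ absUpperRamificationSubgroup (𝓞 K) 𝔓 u,
        σ • geomSqrt d ≠ geomSqrt d})
    (hne : (rationalTateGaloisRepOf (geomPoints W) ℓ h).swanConductorAt (𝓞 K) 𝔓 ≠
      2 * volume.real {u : ℝ | 0 < u ∧ ∃ σ ∈ absUpperRamificationSubgroup (𝓞 K) 𝔓 u,
        σ • geomSqrt d ≠ geomSqrt d}) :
    (rationalTateGaloisRepOf (geomPoints (W.quadraticTwist d)) ℓ h').swanConductorAt (𝓞 K) 𝔓 =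
      max ((rationalTateGaloisRepOf (geomPoints W) ℓ h).swanConductorAt (𝓞 K) 𝔓)
        (2 * volume.real {u : ℝ | 0 < u ∧ ∃ σ ∈ absUpperRamificationSubgroup (𝓞 K) 𝔓 u,
          σ • geomSqrt d ≠ geomSqrt d}) := by
  refine W.swanConductorAt_rationalTate_quadraticTwist_eq_max ℓ hℓ2 hd h h' hℓ h𝔓 ?_
    (volume_ne_top_of_volume_real_pos hposD) hne
  rw [W.swanConductorAt_rationalTate_eq_two_mul_volume ℓ h hℓ h𝔓] at hposE
  exact volume_ne_top_of_volume_real_pos (by linarith)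

attribute [local instance] AddSubgroup.torsionBy.zmodModule

/-- **`E[ℓ]`-form**: `Sw_𝔓(E^{(d)}[ℓ]) = max (Sw_𝔓(E[ℓ]), 2 u_d)` under the same hypotheses
(`Sw_𝔓(V_ℓ E) = Sw_𝔓(E[ℓ])`, `swanConductorAt_rationalTate_eq_swanConductorAt_torsion`).
[cite: SilvermanATAEC1994, §IV.10 Definition of δ (PDF p. 358); Thm. IV.10.2(b),(c) and proof (pp. 358–362)]
[cite: SerreLocalFields1979, Ch. IV §3 Remark 1, Ch. VI §2] -/
theorem swanConductorAt_torsion_quadraticTwist_eq_max_of_pos [W.IsElliptic] (hℓ2 : ℓ ≠ 2)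
    {d : K} (hd : d ≠ 0)
    {v : HeightOneSpectrum (𝓞 K)} (hℓ : (ℓ : 𝓞 K) ∉ v.asIdeal)
    {𝔓 : Ideal (absIntegers (𝓞 K) K)} (h𝔓 : 𝔓 ∈ v.primesAbove)
    (hposE : 0 < (W.torsionGaloisRep ℓ).swanConductorAt (𝓞 K) 𝔓)
    (hposD : 0 < volume.real {u : ℝ | 0 < u ∧ ∃ σ ∈ absUpperRamificationSubgroup (𝓞 K) 𝔓 u,
        σ • geomSqrt d ≠ geomSqrt d})
    (hne : (W.torsionGaloisRep ℓ).swanConductorAt (𝓞 K) 𝔓 ≠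
      2 * volume.real {u : ℝ | 0 < u ∧ ∃ σ ∈ absUpperRamificationSubgroup (𝓞 K) 𝔓 u,
        σ • geomSqrt d ≠ geomSqrt d}) :
    ((W.quadraticTwist d).torsionGaloisRep ℓ).swanConductorAt (𝓞 K) 𝔓 =
      max ((W.torsionGaloisRep ℓ).swanConductorAt (𝓞 K) 𝔓)
        (2 * volume.real {u : ℝ | 0 < u ∧ ∃ σ ∈ absUpperRamificationSubgroup (𝓞 K) 𝔓 u,
          σ • geomSqrt d ≠ geomSqrt d}) := by
  haveI := W.isElliptic_quadraticTwist hd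
  have h := W.continuous_rationalGaloisRepTate_holds ℓ
  have h' := (W.quadraticTwist d).continuous_rationalGaloisRepTate_holds ℓ
  rw [← W.swanConductorAt_rationalTate_eq_swanConductorAt_torsion ℓ h hℓ h𝔓] at hposE hne ⊢
  rw [← (W.quadraticTwist d).swanConductorAt_rationalTate_eq_swanConductorAt_torsion ℓ h' hℓ h𝔓]
  exact W.swanConductorAt_rationalTate_quadraticTwist_eq_max_of_pos ℓ hℓ2 hd h h' hℓ h𝔓 hposE
    hposD hne

/-! ### The unramified twist: `S_d = ∅` -/

omit [Fact ℓ.Prime] in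
/-- **If no `Γ_K^u(𝔓)`, `u > 0`, moves `√d` then `S' = S_E`** (any prime `ℓ`): `S' ⊆ S_E ∪ ∅`,
and a `u ∈ S_E` has an element moving `E[ℓ]` and fixing `√d`, so `u ∈ S'`.  (E.g. `𝔓`
unramified in `K(√d)`; over `ℚ` at `2`: `d ≡ 1 (mod 4)`.)
[cite: SilvermanATAEC1994, proof of Thm. IV.10.2(b), twist argument (PDF pp. 359–360)] -/
theorem setOf_quadraticTwist_eq_of_forall_smul_geomSqrt_eq {d : K} (hd : d ≠ 0)
    (𝔓 : Ideal (absIntegers (𝓞 K) K))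
    (hD : ∀ u : ℝ, 0 < u → ∀ σ ∈ absUpperRamificationSubgroup (𝓞 K) 𝔓 u,
      σ • geomSqrt d = geomSqrt d) :
    {u : ℝ | 0 < u ∧ ∃ σ ∈ absUpperRamificationSubgroup (𝓞 K) 𝔓 u,
        ∃ T : geomTorsion (W.quadraticTwist d) ℓ, σ • T ≠ T} =
      {u : ℝ | 0 < u ∧ ∃ σ ∈ absUpperRamificationSubgroup (𝓞 K) 𝔓 u,
        ∃ T : geomTorsion W ℓ, σ • T ≠ T} := by
  have hDempty : {u : ℝ | 0 < u ∧ ∃ σ ∈ absUpperRamificationSubgroup (𝓞 K) 𝔓 u,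
      σ • geomSqrt d ≠ geomSqrt d} = ∅ :=
    Set.eq_empty_of_forall_notMem fun u ⟨hu, σ, hσ, hne⟩ ↦ hne (hD u hu σ hσ)
  refine Set.Subset.antisymm (fun u hu ↦ ?_) (fun u hu ↦ ?_)
  · have := W.setOf_quadraticTwist_subset_union ℓ hd 𝔓 hu
    rwa [hDempty, Set.union_empty] at this
  · exact W.mem_setOf_quadraticTwist_of_torsion_of_not ℓ hd hu.1 hu.2
      (fun ⟨σ, hσ, hne⟩ ↦ hne (hD u hu.1 σ hσ))

/-- **`Sw_𝔓(V_ℓ E^{(d)}) = Sw_𝔓(V_ℓ E)` when no `Γ_K^u(𝔓)`, `u > 0`, moves `√d`** (any prime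
`ℓ ∉ v`; e.g. `𝔓` unramified in `K(√d)`). [cite: SilvermanATAEC1994, Thm. IV.10.2(b),(c) and proof (PDF pp. 358–362)]
[cite: SerreLocalFields1979, Ch. IV §3 Remark 1, Ch. VI §2] -/
theorem swanConductorAt_rationalTate_quadraticTwist_eq_of_forall_smul_geomSqrt_eq [W.IsElliptic]
    {d : K} (hd : d ≠ 0)
    (h : Continuous fun x : absoluteGaloisGroup K × RationalTateModule (geomPoints W) ℓ ↦
      rationalTateRepresentation (absoluteGaloisGroup K) (geomPoints W) ℓ x.1 x.2)
    (h' : Continuous fun x : absoluteGaloisGroup K ×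
        RationalTateModule (geomPoints (W.quadraticTwist d)) ℓ ↦
      rationalTateRepresentation (absoluteGaloisGroup K) (geomPoints (W.quadraticTwist d)) ℓ
        x.1 x.2)
    {v : HeightOneSpectrum (𝓞 K)} (hℓ : (ℓ : 𝓞 K) ∉ v.asIdeal)
    {𝔓 : Ideal (absIntegers (𝓞 K) K)} (h𝔓 : 𝔓 ∈ v.primesAbove)
    (hD : ∀ u : ℝ, 0 < u → ∀ σ ∈ absUpperRamificationSubgroup (𝓞 K) 𝔓 u,
      σ • geomSqrt d = geomSqrt d) :
    (rationalTateGaloisRepOf (geomPoints (W.quadraticTwist d)) ℓ h').swanConductorAt (𝓞 K) 𝔓 =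
      (rationalTateGaloisRepOf (geomPoints W) ℓ h).swanConductorAt (𝓞 K) 𝔓 := by
  haveI := W.isElliptic_quadraticTwist hd
  rw [W.swanConductorAt_rationalTate_eq_two_mul_volume ℓ h hℓ h𝔓,
    (W.quadraticTwist d).swanConductorAt_rationalTate_eq_two_mul_volume ℓ h' hℓ h𝔓,
    W.setOf_quadraticTwist_eq_of_forall_smul_geomSqrt_eq ℓ hd 𝔓 hD]

/-- **`E[ℓ]`-form**: `Sw_𝔓(E^{(d)}[ℓ]) = Sw_𝔓(E[ℓ])` when no `Γ_K^u(𝔓)`, `u > 0`, moves `√d`.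
[cite: SilvermanATAEC1994, §IV.10 Definition of δ (PDF p. 358); Thm. IV.10.2(b),(c) and proof (pp. 358–362)]
[cite: SerreLocalFields1979, Ch. IV §3 Remark 1, Ch. VI §2] -/
theorem swanConductorAt_torsion_quadraticTwist_eq_of_forall_smul_geomSqrt_eq [W.IsElliptic]
    {d : K} (hd : d ≠ 0)
    {v : HeightOneSpectrum (𝓞 K)} (hℓ : (ℓ : 𝓞 K) ∉ v.asIdeal)
    {𝔓 : Ideal (absIntegers (𝓞 K) K)} (h𝔓 : 𝔓 ∈ v.primesAbove)
    (hD : ∀ u : ℝ, 0 < u → ∀ σ ∈ absUpperRamificationSubgroup (𝓞 K) 𝔓 u,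
      σ • geomSqrt d = geomSqrt d) :
    ((W.quadraticTwist d).torsionGaloisRep ℓ).swanConductorAt (𝓞 K) 𝔓 =
      (W.torsionGaloisRep ℓ).swanConductorAt (𝓞 K) 𝔓 := by
  haveI := W.isElliptic_quadraticTwist hd
  have h := W.continuous_rationalGaloisRepTate_holds ℓ
  have h' := (W.quadraticTwist d).continuous_rationalGaloisRepTate_holds ℓ
  rw [← W.swanConductorAt_rationalTate_eq_swanConductorAt_torsion ℓ h hℓ h𝔓,
    ← (W.quadraticTwist d).swanConductorAt_rationalTate_eq_swanConductorAt_torsion ℓ h' hℓ h𝔓]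
  exact W.swanConductorAt_rationalTate_quadraticTwist_eq_of_forall_smul_geomSqrt_eq ℓ hd h h'
    hℓ h𝔓 hD

end WeierstrassCurve

/-! ## §5. Over `ℚ` at the place above `2`, `d ∈ ℤ` -/

namespace WeierstrassCurve

open Literature.NumberTheory.EllipticCurves Literature.NumberTheory.GaloisRepresentations

variable (W : WeierstrassCurve ℚ) (ℓ : ℕ) [Fact ℓ.Prime]

attribute [local instance] AddSubgroup.torsionBy.zmodModule

/-- **`Sw(E^{(d)}[ℓ]) = Sw(E[ℓ])` at `2` for `d ≡ 1 (mod 4)`** (`W/ℚ` elliptic, `ℓ ∉ v ∋ 2`,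
`𝔓 ∣ 2`): inertia above `2` fixes `√d` (`Rat.smul_geomSqrt_eq_of_mem_inertia_of_emod_four_eq_one`,
`ℚ(√d)` is unramified at `2`), so no `Γ^u ≤ I_𝔓` moves it.
[cite: SilvermanATAEC1994, Thm. IV.10.2(b),(c) and proof (PDF pp. 358–362); Thm. IV.11.1, p = 2 (p. 366)]
[cite: SerreLocalFields1979, Ch. IV §3 Remark 1, Ch. VI §2] -/
theorem Rat.swanConductorAt_torsion_quadraticTwist_eq_of_emod_four_eq_one
    [W.IsElliptic] {d : ℤ} (hd : d % 4 = 1) (hd0 : d ≠ 0)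
    {v : HeightOneSpectrum (𝓞 ℚ)} (hv : (2 : 𝓞 ℚ) ∈ v.asIdeal) (hℓ : (ℓ : 𝓞 ℚ) ∉ v.asIdeal)
    {𝔓 : Ideal (absIntegers (𝓞 ℚ) ℚ)} (h𝔓 : 𝔓 ∈ v.primesAbove) :
    ((W.quadraticTwist (d : ℚ)).torsionGaloisRep ℓ).swanConductorAt (𝓞 ℚ) 𝔓 =
      (W.torsionGaloisRep ℓ).swanConductorAt (𝓞 ℚ) 𝔓 :=
  W.swanConductorAt_torsion_quadraticTwist_eq_of_forall_smul_geomSqrt_eq ℓ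
    (by exact_mod_cast hd0) hℓ h𝔓 fun u _ σ hσ ↦
      Rat.smul_geomSqrt_eq_of_mem_inertia_of_emod_four_eq_one hd hv h𝔓
        (absUpperRamificationSubgroup_le_inertia_holds (𝓞 ℚ) 𝔓 u hσ)

/-- **`Sw(E^{(d)}[ℓ]) = max (Sw(E[ℓ]), 2)` at `2` for `d ≡ 3 (mod 4)`** (`W/ℚ` elliptic, `ℓ`
odd, `𝔓 ∣ 2`, `Sw(E[ℓ]) ∉ {0, 2}`): the upper break of `ℚ₂(√d)` is `u_d = 1`
(`Rat.volume_real_setOf_smul_sqrt_ne_of_emod_four_eq_three`).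
[cite: SilvermanATAEC1994, Thm. IV.10.2(b),(c) and proof (PDF pp. 358–362); Thm. IV.11.1, p = 2 (p. 366)]
[cite: SerreLocalFields1979, Ch. IV §3 Remark 1, Ch. VI §2] -/
theorem Rat.swanConductorAt_torsion_quadraticTwist_eq_max_two_of_emod_four_eq_three
    [W.IsElliptic] (hℓ2 : ℓ ≠ 2) {d : ℤ} (hd : d % 4 = 3)
    {v : HeightOneSpectrum (𝓞 ℚ)} (hv : (2 : 𝓞 ℚ) ∈ v.asIdeal) (hℓ : (ℓ : 𝓞 ℚ) ∉ v.asIdeal)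
    {𝔓 : Ideal (absIntegers (𝓞 ℚ) ℚ)} (h𝔓 : 𝔓 ∈ v.primesAbove)
    (hposE : 0 < (W.torsionGaloisRep ℓ).swanConductorAt (𝓞 ℚ) 𝔓)
    (hne : (W.torsionGaloisRep ℓ).swanConductorAt (𝓞 ℚ) 𝔓 ≠ 2) :
    ((W.quadraticTwist (d : ℚ)).torsionGaloisRep ℓ).swanConductorAt (𝓞 ℚ) 𝔓 =
      max ((W.torsionGaloisRep ℓ).swanConductorAt (𝓞 ℚ) 𝔓) 2 := by
  have hd0 : (d : ℚ) ≠ 0 := by exact_mod_cast (show d ≠ 0 by omega)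
  have hvol := Rat.volume_real_setOf_smul_sqrt_ne_of_emod_four_eq_three hd (geomSqrt_sq (d : ℚ))
    hv h𝔓
  have key := W.swanConductorAt_torsion_quadraticTwist_eq_max_of_pos ℓ hℓ2 hd0 hℓ h𝔓 hposE
    (by rw [hvol]; norm_num) (by rw [hvol]; norm_num; exact hne)
  rw [hvol] at key
  norm_num at key
  exact key

/-- **`Sw(E^{(d)}[ℓ]) = max (Sw(E[ℓ]), 4)` at `2` for `d ≡ 2 (mod 4)`** (`W/ℚ` elliptic, `ℓ`
odd, `𝔓 ∣ 2`, `Sw(E[ℓ]) ∉ {0, 4}`): the upper break of `ℚ₂(√d)` is `u_d = 2`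
(`Rat.volume_real_setOf_smul_sqrt_ne_of_emod_four_eq_two`).
[cite: SilvermanATAEC1994, Thm. IV.10.2(b),(c) and proof (PDF pp. 358–362); Thm. IV.11.1, p = 2 (p. 366)]
[cite: SerreLocalFields1979, Ch. IV §3 Remark 1, Ch. VI §2] -/
theorem Rat.swanConductorAt_torsion_quadraticTwist_eq_max_four_of_emod_four_eq_two
    [W.IsElliptic] (hℓ2 : ℓ ≠ 2) {d : ℤ} (hd : d % 4 = 2)
    {v : HeightOneSpectrum (𝓞 ℚ)} (hv : (2 : 𝓞 ℚ) ∈ v.asIdeal) (hℓ : (ℓ : 𝓞 ℚ) ∉ v.asIdeal)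
    {𝔓 : Ideal (absIntegers (𝓞 ℚ) ℚ)} (h𝔓 : 𝔓 ∈ v.primesAbove)
    (hposE : 0 < (W.torsionGaloisRep ℓ).swanConductorAt (𝓞 ℚ) 𝔓)
    (hne : (W.torsionGaloisRep ℓ).swanConductorAt (𝓞 ℚ) 𝔓 ≠ 4) :
    ((W.quadraticTwist (d : ℚ)).torsionGaloisRep ℓ).swanConductorAt (𝓞 ℚ) 𝔓 =
      max ((W.torsionGaloisRep ℓ).swanConductorAt (𝓞 ℚ) 𝔓) 4 := by
  have hd0 : (d : ℚ) ≠ 0 := by exact_mod_cast (show d ≠ 0 by omega)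
  have hvol := Rat.volume_real_setOf_smul_sqrt_ne_of_emod_four_eq_two hd (geomSqrt_sq (d : ℚ))
    hv h𝔓
  have key := W.swanConductorAt_torsion_quadraticTwist_eq_max_of_pos ℓ hℓ2 hd0 hℓ h𝔓 hposE
    (by rw [hvol]; norm_num) (by rw [hvol]; norm_num; exact hne)
  rw [hvol] at key
  norm_num at key
  exact key

end WeierstrassCurve

end
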